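import Literature.AlgebraicGeometry.HodgeTheory.CanonicalTrace
import Literature.AlgebraicGeometry.HodgeTheory.CycleClassOfResolutions
import Literature.AlgebraicGeometry.HodgeTheory.ComplexOrientationDegreeFibre
import Literature.AlgebraicTopology.SingularHomology.GysinTransposition
import Literature.AlgebraicTopology.CharacteristicClasses.TopologicalChernClasses
import HarnessLib

/-!
# The canonical trace: Gysin invariance, `∫_X [pt] = 1`, and `0`-cycles

Layer `Literature/AlgebraicGeometry/HodgeTheory`; theorems only. Continuation of
`HodgeTheory/CanonicalTrace` (the canonical trace `∫_X = traceC hX : H²ⁿ(X(ℂ); ℂ) → ℂ`,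
`a ↦ ε₀⁻¹ ⟨a, [X(ℂ)]⟩`, of a smooth projective `X` of dimension `n`) on the side of the Gysin
morphisms `complexGysin complexOrientationFamily` (`HodgeTheory/ComplexGysin`) and of the cycle classes
`cycleClass complexOrientationFamily` through resolutions (`HodgeTheory/CycleClassOfResolutions`):

* `traceC_complexGysin` — **`∫_X f_* y = ∫_Y y`** for every `f : Y ⟶ X` (Fulton, *Young Tableaux*
  App. B (5): `f_* y ⌢ [X] = f(ℂ)_*(y ⌢ [Y])` and the augmentation is natural), and the projection
  formula form `traceC_cup_complexGysin`: `∫_X (f_* y ∪ x) = ∫_Y (y ∪ f^* x)`;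
* `traceC_one_of_dim_zero` — **`∫_P 1 = 1`** for `P` smooth projective of dimension `0` (`P(ℂ)` is a
  point; the structure map `q : P ⟶ Spec ℂ` has `q_* 1 = 1` by the tree's finite-fibre degree formula
  `complexGysin_complexOrientationFamily_one_of_finite_fibre`, and `∫_{Spec ℂ} 1 = ε₀⁻¹ ε₀ = 1` by the
  definition of the point sign `ε₀`);
* hence **`∫_X [pt] = 1`**: `traceC_complexGysin_one_of_dim_zero` (`∫_X i_* 1_P = 1` for `i : P ⟶ X`,
  `dim P = 0`), `traceC_primeClass_of_height_eq_zero`, and `traceC_cycleClass_dim_zero`: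
  **`∫_X cl(Z) = deg Z = Σ_z Z(z)`** for every `0`-cycle `Z` (Fulton Def. 1.4, Voisin I §11.1.4);
* `trace_map_of_hasDegree` / `traceC_map_of_map_fundamentalClass` — **`∫_{X'} f^* a = d · ∫_X a`**
  for `f(ℂ)_*[X'] = d • [X]` (`HasDegree`), with the two cases the tree supplies:
  `trace_map_of_isBirational` (`∫_{X'} σ^* a = ∫_X a`, `HodgeTheory/ComplexOrientationDegreeOne`) and
  `trace_map_of_finite_fibre` (`∫_T q^* a = #(fibre) · ∫_W a`, `HodgeTheory/ComplexOrientationDegreeFibre`).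

All identities are free of the convention signs `ε(n)` of `ComplexOrientationFamily` (they enter
both sides); see the scope note of `HodgeTheory/CanonicalTrace`. Not here, for the same reason: the
product formula `∫_{X × Y} (pr₁^* a ∪ pr₂^* b) = ∫_X a · ∫_Y b`, which compares `[X × Y]` with
`[X] × [Y]` and hence the conventions in dimensions `m + n`, `m`, `n` (it holds up to that sign).

## References

* [FultonYoungTableaux1997] W. Fulton, Young Tableaux, CUP 1997, App. B §B.1 (5)–(6).
* [Fulton1998] W. Fulton, Intersection Theory, 2nd ed. 1998, §1.4 Def. 1.4, Lemma 19.1.2.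
* [VoisinHodgeI2002] C. Voisin, Hodge Theory and Complex Algebraic Geometry I, CUP 2002, §11.1.2,
  §11.1.4.
* [HatcherAT2002] A. Hatcher, Algebraic Topology, CUP 2002, §3.1 p. 201, §3.3 p. 241, Exercises 7–8.
-/

noncomputable section

open CategoryTheory AlgebraicGeometry MonoidalCategory
open Literature.AlgebraicTopology.SingularHomology

namespace Literature.AlgebraicGeometry.HodgeTheory

section HodgeTheory

/-! ### §0 Smooth projective varieties of dimension `0` -/

/-- A connected space charted on `ℝ⁰` is a single point: chart sources are open singletons, so the
topology is discrete, and a discrete connected space has at most one point. [folklore] -/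
private theorem subsingleton_of_chartedSpace_fin_zero (M : Type) [TopologicalSpace M]
    [ChartedSpace (EuclideanSpace ℝ (Fin 0)) M] [ConnectedSpace M] : Subsingleton M := by
  have hopen : ∀ x : M, IsOpen ({x} : Set M) := fun x ↦ by
    have hsub : (chartAt (EuclideanSpace ℝ (Fin 0)) x).source ⊆ {x} := fun y hy ↦
      (chartAt (EuclideanSpace ℝ (Fin 0)) x).injOn hy (mem_chart_source _ x) (Subsingleton.elim _ _)
    have heq : (chartAt (EuclideanSpace ℝ (Fin 0)) x).source = {x} :=
      Set.Subset.antisymm hsub (Set.singleton_subset_iff.2 (mem_chart_source _ x))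
    exact heq ▸ (chartAt (EuclideanSpace ℝ (Fin 0)) x).open_source
  haveI : DiscreteTopology M := ⟨eq_bot_of_singletons_open hopen⟩
  exact ⟨fun x y ↦ (isPreconnected_univ (α := M)).subsingleton (Set.mem_univ x) (Set.mem_univ y)⟩

variable {n : ℕ} {X : Motives.SchemeOver ℂ}

/-- `(Spec ℂ)(ℂ)`-type spaces: for `P` smooth projective of dimension `0`, `P(ℂ)` is a single point
(a connected `0`-manifold). [folklore] -/
private theorem subsingleton_complexPoints_of_dim_zero {P : Motives.SchemeOver ℂ}
    (hP : Motives.IsSmoothProjective 0 P) : Subsingleton (Motives.ComplexPoints P) := by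
  letI := hP.chartedSpace
  haveI := connectedSpace_complexPoints hP
  exact subsingleton_of_chartedSpace_fin_zero (Motives.ComplexPoints P)

/-- For `P` smooth projective of dimension `0`, `P(ℂ)` is non-empty (connected). [folklore] -/
private theorem nonempty_complexPoints_of_dim_zero {P : Motives.SchemeOver ℂ}
    (hP : Motives.IsSmoothProjective 0 P) : Nonempty (Motives.ComplexPoints P) :=
  (connectedSpace_complexPoints hP).toNonempty

/-! ### §1 Gysin invariance and the normalisation `∫_X [pt] = 1` -/

variable {m : ℕ} {Y : Motives.SchemeOver ℂ}

/-- **`∫_X f_* y = ∫_Y y`**: the trace is invariant under the Gysin morphisms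
`f_* : H²ᵐ(Y(ℂ); ℂ) → H²ⁿ(X(ℂ); ℂ)` of the complex orientation family (`f_* y ⌢ [X] = f(ℂ)_*(y ⌢ [Y])`
and the augmentation is natural; the point sign is the same on both sides).
[cite: FultonYoungTableaux1997, Appendix B §B.1 (5)] -/
theorem traceC_complexGysin (hY : Motives.IsSmoothProjective m Y)
    (hX : Motives.IsSmoothProjective n X) (f : Y ⟶ X) (hab : 2 * m + 2 * n = 2 * n + 2 * m)
    (y : complexBetti Y (2 * m)) :
    traceC hX (complexGysin complexOrientationFamily hY hX f hab y) = traceC hY y := by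
  rw [traceC_apply, traceC_apply,
    complexGysin_eq_gysinMap hY hX f hab (q := 0) (Nat.add_zero _) (Nat.add_zero _),
    kroneckerPairing_gysinMap_fundamentalClass (hasPoincareDuality_complexOrientationFamily hX)]

/-- **`∫_X (f_* y ∪ x) = ∫_Y (y ∪ f^* x)`**: the trace transposes the Gysin morphism into the
pull-back (projection formula `f_*(y ∪ f^* x) = f_* y ∪ x` and `∫_X f_* = ∫_Y`).
[cite: FultonYoungTableaux1997, Appendix B §B.1 (5)–(6)] -/
theorem traceC_cup_complexGysin (hY : Motives.IsSmoothProjective m Y)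
    (hX : Motives.IsSmoothProjective n X) (f : Y ⟶ X) {a b q : ℕ} (hab : a + 2 * n = b + 2 * m)
    (ha : a + q = 2 * m) (hb : b + q = 2 * n) (y : complexBetti Y a) (x : complexBetti X q) :
    traceC hX (cupProduct hb (complexGysin complexOrientationFamily hY hX f hab y) x) =
      traceC hY (cupProduct ha y (complexBetti.map f q x)) := by
  rw [traceC_apply, traceC_apply, complexGysin_eq_gysinMap hY hX f hab ha hb, ← cupPairing_apply,
    cupPairing_gysinMap (hasPoincareDuality_complexOrientationFamily hX), cupPairing_apply]

/-- **`∫_{Spec ℂ} 1 = 1`**, and more generally `∫_P 1 = 1` for every smooth projective `P` of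
dimension `0`: `P(ℂ)` is one point, the structure map `q : P ⟶ Spec ℂ` has `q_* 1 = 1` (degree one:
a single-point fibre of a local homeomorphism, `complexGysin_complexOrientationFamily_one_of_finite_fibre`),
so `∫_P 1 = ∫_{Spec ℂ} q_* 1 = ∫_{Spec ℂ} 1 = ε₀⁻¹ ε₀ = 1`. [cite: Fulton1998, §1.4 and Lemma 19.1.2] -/
theorem traceC_one_of_dim_zero {P : Motives.SchemeOver ℂ} (hP : Motives.IsSmoothProjective 0 P) :
    traceC hP (singularCohomology.one ℂ (Motives.ComplexPoints P)) = 1 := by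
  have hU : Motives.IsSmoothProjective 0 (𝟙_ (Motives.SchemeOver ℂ)) :=
    Motives.isSmoothProjective_unit_holds ℂ
  haveI := subsingleton_complexPoints_of_dim_zero hP
  haveI := subsingleton_complexPoints_of_dim_zero hU
  obtain ⟨p₀⟩ := nonempty_complexPoints_of_dim_zero hP
  -- the structure morphism and its Gysin image of `1`
  let q : P ⟶ 𝟙_ (Motives.SchemeOver ℂ) := CartesianMonoidalCategory.toUnit P
  have hfibre : (Motives.AlgPoints.map (L := ℂ) q) ⁻¹' {Motives.AlgPoints.map (L := ℂ) q p₀} =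
      Set.range (fun _ : Unit ↦ p₀) := by
    ext x
    obtain rfl : x = p₀ := Subsingleton.elim _ _
    simp
  have hloc : ∀ _ : Unit, ∃ e : OpenPartialHomeomorph (Motives.ComplexPoints P)
      (Motives.ComplexPoints (𝟙_ (Motives.SchemeOver ℂ))),
      p₀ ∈ e.source ∧ (e : Motives.ComplexPoints P → _) = Motives.AlgPoints.map (L := ℂ) q := by
    let e : Motives.ComplexPoints P ≃ₜ Motives.ComplexPoints (𝟙_ (Motives.SchemeOver ℂ)) :=
      { toFun := Motives.AlgPoints.map (L := ℂ) q
        invFun := fun _ ↦ p₀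
        left_inv := fun _ ↦ Subsingleton.elim _ _
        right_inv := fun _ ↦ Subsingleton.elim _ _
        continuous_toFun := Motives.AlgPoints.continuous_map (L := ℂ) q
        continuous_invFun := continuous_const }
    exact fun _ ↦ ⟨e.toOpenPartialHomeomorph, by simp, rfl⟩
  have hq : complexGysin complexOrientationFamily hP hU q (rfl : 0 + 2 * 0 = 0 + 2 * 0)
      (singularCohomology.one ℂ (Motives.ComplexPoints P)) =
      singularCohomology.one ℂ (Motives.ComplexPoints (𝟙_ (Motives.SchemeOver ℂ))) := by
    rw [complexGysin_complexOrientationFamily_one_of_finite_fibre hP hU q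
      (v := fun _ : Unit ↦ p₀) (fun _ _ _ ↦ Subsingleton.elim _ _) hfibre hloc]
    simp
  -- `∫_{Spec ℂ} 1 = ε₀⁻¹ ε₀ = 1`
  have hunit :
      traceC hU (singularCohomology.one ℂ (Motives.ComplexPoints (𝟙_ (Motives.SchemeOver ℂ)))) = 1 := by
    rw [← Literature.AlgebraicTopology.CharacteristicClasses.ringChange_one (algebraMap ℚ ℂ),
      traceC_ringChange, trace_apply]
    change algebraMap ℚ ℂ (pointSign⁻¹ * pointSign) = 1
    rw [inv_mul_cancel₀ pointSign_ne_zero, map_one]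
  rw [← hunit, ← hq, traceC_complexGysin hP hU q]

/-- **`∫_X [pt] = 1` (Gysin form)**: for a morphism `i : P ⟶ X` from a smooth projective `P` of
dimension `0` (a point of `X`), the class `i_* 1_P ∈ H²ⁿ(X(ℂ); ℂ)` has trace `1`.
[cite: VoisinHodgeI2002, §11.1.2] [cite: Fulton1998, §1.4] -/
theorem traceC_complexGysin_one_of_dim_zero {P : Motives.SchemeOver ℂ}
    (hP : Motives.IsSmoothProjective 0 P) (hX : Motives.IsSmoothProjective n X) (i : P ⟶ X)
    (hab : 2 * 0 + 2 * n = 2 * n + 2 * 0) :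
    traceC hX (complexGysin complexOrientationFamily hP hX i hab
      (singularCohomology.one ℂ (Motives.ComplexPoints P))) = 1 := by
  rw [traceC_complexGysin hP hX i hab, traceC_one_of_dim_zero hP]

/-- **`∫_X [closure {z}] = 1` for a closed point `z`**: the class of the prime `0`-cycle of a point of
dimension `0` through any resolution family has trace `1`. [cite: VoisinHodgeI2002, §11.1.4] -/
theorem traceC_primeClass_of_height_eq_zero (hX : Motives.IsSmoothProjective n X)
    (hde : 0 + n = n) (ρ : ResolutionFamily X 0) {z : X.left} (hz : Order.height z = ((0 : ℕ) : ℕ∞)) :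
    traceC hX (primeClass complexOrientationFamily hX hde ρ z) = 1 := by
  rw [primeClass_of_height_eq complexOrientationFamily hX hde ρ hz]
  exact traceC_complexGysin_one_of_dim_zero (ρ.smooth ⟨z, hz⟩) hX (ρ.hom ⟨z, hz⟩) _

/-- The class of the prime cycle at a point of positive dimension is `0` in the `0`-cycle grading, so
its trace vanishes. [cite: VoisinHodgeI2002, §11.1.4] -/
theorem traceC_primeClass_of_height_ne_zero (hX : Motives.IsSmoothProjective n X)
    (hde : 0 + n = n) (ρ : ResolutionFamily X 0) {z : X.left} (hz : Order.height z ≠ ((0 : ℕ) : ℕ∞)) :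
    traceC hX (primeClass complexOrientationFamily hX hde ρ z) = 0 := by
  rw [primeClass_of_height_ne complexOrientationFamily hX hde ρ hz, map_zero]

/-- **`∫_X cl(Z) = deg Z` for `0`-cycles**: for every `0`-cycle `Z = Σ_z Z(z) [z]` on `X` and every
resolution family, the tree's cycle class `cl(Z) = Σ_z Z(z) τ_{z*} 1 ∈ H²ⁿ(X(ℂ); ℂ)`
(`cycleClass complexOrientationFamily`) has trace the degree `Σ_z Z(z)` of `Z` (Fulton Def. 1.4).
[cite: Fulton1998, §1.4 Definition 1.4] [cite: VoisinHodgeI2002, §11.1.4] -/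
theorem traceC_cycleClass_dim_zero (hX : Motives.IsSmoothProjective n X) (hde : 0 + n = n)
    (ρ : ResolutionFamily X 0) (Z : ↥(Motives.cyclesOfDim X.left 0)) :
    traceC hX (cycleClass complexOrientationFamily hX hde ρ Z) =
      ∑ᶠ z, (((Z : AlgebraicCycle X.left ℤ) z : ℤ) : ℂ) := by
  classical
  have hfin := finite_support_of_isSmoothProjective hX (Z : AlgebraicCycle X.left ℤ)
  rw [cycleClass_eq_sum complexOrientationFamily hX hde ρ Z (s := hfin.toFinset) (by simp),
    map_sum, finsum_eq_sum_of_support_subset _ (s := hfin.toFinset)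
      (fun z hz ↦ by simpa using fun h ↦ hz (by simp [h]))]
  refine Finset.sum_congr rfl fun z hz ↦ ?_
  rw [map_smul, smul_eq_mul]
  have hz' : (Z : AlgebraicCycle X.left ℤ) z ≠ 0 := by simpa using hz
  rw [traceC_primeClass_of_height_eq_zero hX hde ρ (Motives.mem_cyclesOfDim_iff.1 Z.2 z hz'), mul_one]

/-! ### §2 Pull-back by a morphism of degree `d` -/

/-- **`∫_{X'} f^* a = d · ∫_X a`** for `f : X' ⟶ X` between smooth projective varieties of the same
dimension with `f(ℂ)_* [X'(ℂ)] = d • [X(ℂ)]` for the rational complex orientations (`HasDegree`; supplied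
by the tree for generically finite morphisms, `hasDegree_complexOrientationRat_of_finite_fibre`, and for
birational ones, `hasDegree_one_complexOrientationRat_of_isBirational`): `⟨f^* a, [X']⟩ = ⟨a, f_*[X']⟩`.
[cite: HatcherAT2002, §3.3 Exercises 7–8 and §3.1 p. 201] [cite: Fulton1998, Lemma 19.1.2] -/
theorem trace_map_of_hasDegree {X' : Motives.SchemeOver ℂ} (hX' : Motives.IsSmoothProjective n X')
    (hX : Motives.IsSmoothProjective n X) (f : X' ⟶ X) {d : ℤ}
    (hf : HasDegree (complexOrientationRat hX') (complexOrientationRat hX)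
      (Motives.AlgPoints.mapContinuous (L := ℂ) f) d)
    (a : singularCohomology ℚ ℚ (Motives.ComplexPoints X) (2 * n)) :
    trace hX' (Motives.bettiCohomology.map f (2 * n) a) = d * trace hX a := by
  rw [HasDegree] at hf
  rw [trace_apply, trace_apply, Motives.bettiCohomology.map, kroneckerPairing_map, hf, map_zsmul,
    zsmul_eq_mul, mul_left_comm]

/-- **`∫_{X'} f^* a = d · ∫_X a` over `ℂ`**, from `f(ℂ)_* [X'(ℂ)] = d • [X(ℂ)]` for the complex
orientation family (e.g. `map_fundamentalClass_complexOrientationFamily_of_finite_fibre`,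
`map_fundamentalClass_complexOrientationFamily_of_isBirational`).
[cite: HatcherAT2002, §3.3 Exercises 7–8 and §3.1 p. 201] [cite: Fulton1998, Lemma 19.1.2] -/
theorem traceC_map_of_map_fundamentalClass {X' : Motives.SchemeOver ℂ}
    (hX' : Motives.IsSmoothProjective n X') (hX : Motives.IsSmoothProjective n X) (f : X' ⟶ X)
    {d : ℂ} (hf : singularHomology.map ℂ ℂ (Motives.AlgPoints.mapContinuous (L := ℂ) f) (2 * n)
        (complexOrientationFamily hX').fundamentalClass =
      d • (complexOrientationFamily hX).fundamentalClass)
    (a : complexBetti X (2 * n)) :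
    traceC hX' (complexBetti.map f (2 * n) a) = d * traceC hX a := by
  rw [traceC_apply, traceC_apply, complexBetti.map, kroneckerPairing_map, hf, map_smul, smul_eq_mul,
    mul_left_comm]

/-- **`∫_{X'} σ^* a = ∫_X a` for a birational morphism** `σ : X' ⟶ X` of smooth projective `n`-folds
(degree `+1` for the rational complex orientations, `hasDegree_one_complexOrientationRat_of_isBirational`).
[cite: Fulton1998, Lemma 19.1.2 and §1.4] -/
theorem trace_map_of_isBirational {X' : Motives.SchemeOver ℂ} (hX' : Motives.IsSmoothProjective n X')
    (hX : Motives.IsSmoothProjective n X) (σ : X' ⟶ X) (hσ : Resolution.IsBirational σ.left)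
    (a : singularCohomology ℚ ℚ (Motives.ComplexPoints X) (2 * n)) :
    trace hX' (Motives.bettiCohomology.map σ (2 * n) a) = trace hX a := by
  rw [trace_map_of_hasDegree hX' hX σ (hasDegree_one_complexOrientationRat_of_isBirational hX' hX σ hσ),
    Int.cast_one, one_mul]

/-- **`∫_T q^* a = (#ι) · ∫_W a` for a morphism with a finite fibre of local homeomorphism points**
`q : T ⟶ W` of smooth projective `d`-folds (`#ι = deg q` read off the fibre `{v i}` over `b`; Fulton
Lemma 19.1.2 via `hasDegree_complexOrientationRat_of_finite_fibre`).
[cite: Fulton1998, Lemma 19.1.2] [cite: HatcherAT2002, §2.2 Prop. 2.30] -/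
theorem trace_map_of_finite_fibre {d : ℕ} {T W : Motives.SchemeOver ℂ}
    (hT : Motives.IsSmoothProjective d T) (hW : Motives.IsSmoothProjective d W) (q : T ⟶ W)
    {ι : Type} [Fintype ι] {v : ι → Motives.ComplexPoints T} (hv : Function.Injective v)
    {b : Motives.ComplexPoints W} (hfibre : (Motives.AlgPoints.map q) ⁻¹' {b} = Set.range v)
    (hloc : ∀ i, ∃ e : OpenPartialHomeomorph (Motives.ComplexPoints T) (Motives.ComplexPoints W),
      v i ∈ e.source ∧ (e : Motives.ComplexPoints T → Motives.ComplexPoints W) = Motives.AlgPoints.map q)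
    (a : singularCohomology ℚ ℚ (Motives.ComplexPoints W) (2 * d)) :
    trace hT (Motives.bettiCohomology.map q (2 * d) a) = Fintype.card ι * trace hW a := by
  rw [trace_map_of_hasDegree hT hW q (hasDegree_complexOrientationRat_of_finite_fibre hT hW q hv hfibre hloc),
    Int.cast_natCast]

end HodgeTheory

end Literature.AlgebraicGeometry.HodgeTheory

end
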